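import Summits.CriticalPhenomena.SAWScalingLimit.Theorems.SAWSpinMonotoneSpinMonotoneAdjacentPortReduction

/-!
# The source-port mass is `x_c`; the adjacent-port witness in terms of the two generating functions

Crux `stmt-CriticalPhenomena-16769` (`SpinMonotone`, route `SAWSpinMonotone`), line `Sketch`. At an adjacent configuration the only
walk of `Λ ∖ v` from `a = {u, w₁}` to the port `{v, w₁}` is the one-vertex walk `[w₁]`, so `portMass Λ a v w₁ = x_c`
(`portMass_source_eq`). Consequently the hypothesis `AdjacentPortWitness` of the negative-modulo lemma
`SpinMonotone_false_of_AdjacentPortWitness` reads, with `m₁ = portMass … p = x_c·R_mid` and `m₂ = portMass … q = x_c·R_far`,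
`m₁ (x_c + m₂) < 4 x_c m₂`, i.e. `R_mid (1 + R_far) < 4 R_far` — exactly the margin `m(W,Y)` computed by the transfer matrices of
`Cruxes/SpinMonotone/NUMERICS.md` (`adjacentPortWitness_iff_source`). Source: H. Duminil-Copin, S. Smirnov, Ann. of Math. 175 (2012),
arXiv:1007.0575, §1–2 (walks between mid-edges; "the only walk from `a` to `a` is the trivial one").
-/

noncomputable section

namespace Summit.CriticalPhenomena.SAWScalingLimit.Cruxes.SpinMonotone.AdjacentPort

open Literature.Probability.LatticeModels
open Literature.Probability.RandomPlanarGeometry Literature.Probability.RandomPlanarGeometry.SAW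
open Summit.CriticalPhenomena.SAWScalingLimit.Cruxes.ArrivalFlattening.SpinChord (portMass)

variable {Λ : Finset HexVertex} {u w₁ v : HexVertex}

/-- There is a walk (the one-vertex walk `[w₁]`) from `{u, w₁}` to the port `{v, w₁}` of a target `v ∼ w₁` (`u ∉ Λ`, `w₁ ∈ Λ`,
`v ∈ Λ`). [cite: DuminilCopinSmirnov2012, §1–2 (walks between mid-edges)] -/
theorem nonempty_sourceWalk (hu : u ∉ Λ) (hw₁ : w₁ ∈ Λ) (hv : v ∈ Λ) (huw : hexGraph.Adj u w₁) (hvw : hexGraph.Adj v w₁) :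
    Nonempty (HexMidEdgeSAW (Λ.erase v) s(u, w₁) s(v, w₁)) :=
  ⟨{ verts := [w₁]
     subset := by
       intro x hx
       rw [List.mem_singleton] at hx
       subst hx
       exact Finset.mem_erase.2 ⟨hvw.ne.symm, hw₁⟩
     nodup := List.nodup_singleton _
     isChain := List.isChain_singleton _
     head_mem := by
       intro x hx; simp only [List.head?_cons, Option.some.injEq] at hx; rw [← hx]; exact Sym2.mem_mk_right u w₁
     getLast_mem := by
       intro x hx; simp only [List.getLast?_singleton, Option.some.injEq] at hx; rw [← hx]; exact Sym2.mem_mk_right v w₁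
     eq_of_nil := by intro h; simp at h
     edges_nodup := by
       intro _
       simp only [List.tail_cons, List.zipWith_nil_right, List.nil_append, List.cons_append, List.nodup_cons, List.mem_singleton,
         List.not_mem_nil, not_false_eq_true, List.nodup_nil, and_true]
       intro h
       have hu' : u ∈ s(v, w₁) := h ▸ Sym2.mem_mk_left u w₁
       rcases Sym2.mem_iff.1 hu' with rfl | rfl
       · exact hu hv
       · exact hu hw₁
     fst_mem := ⟨(SimpleGraph.mem_edgeSet hexGraph).2 huw, w₁, Sym2.mem_mk_right u w₁,
       Finset.mem_erase.2 ⟨hvw.ne.symm, hw₁⟩⟩ }⟩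

/-- Every walk of `Λ ∖ v` from `{u, w₁}` to the port `{v, w₁}` is the one-vertex walk. [cite: DuminilCopinSmirnov2012, §1–2] -/
theorem verts_eq_singleton_of_source_port (hu : u ∉ Λ) (hv : v ∈ Λ) (hvw : hexGraph.Adj v w₁)
    (γ : HexMidEdgeSAW (Λ.erase v) s(u, w₁) s(v, w₁)) : γ.verts = [w₁] := by
  have hu' : u ∉ Λ.erase v := fun h => hu (Finset.mem_of_mem_erase h)
  have hne := verts_ne_nil_of_port hu hv hvw γ
  have hhead := γ.head_eq rfl hu' hne
  have hlast := (getLast_eq_of_port γ hne).1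
  have h1 := length_eq_one_of_head_eq_getLast hne γ.nodup (hhead.trans hlast.symm)
  obtain ⟨x, rest, hx⟩ := List.exists_cons_of_ne_nil hne
  have hrest : rest = [] := by simpa [hx] using h1
  subst hrest
  have hxw : x = w₁ := by rw [← hhead]; simp [hx]
  rw [hx, hxw]

/-- **The source-port mass is `x_c`** at an adjacent configuration. [cite: DuminilCopinSmirnov2012, §1–2] -/
theorem portMass_source_eq (hu : u ∉ Λ) (hw₁ : w₁ ∈ Λ) (hv : v ∈ Λ) (huw : hexGraph.Adj u w₁) (hvw : hexGraph.Adj v w₁) :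
    portMass Λ s(u, w₁) v w₁ = hexCriticalFugacity := by
  obtain ⟨γ₀⟩ := nonempty_sourceWalk hu hw₁ hv huw hvw
  have hcard : Fintype.card (HexMidEdgeSAW (Λ.erase v) s(u, w₁) s(v, w₁)) = 1 :=
    Fintype.card_eq_one_iff.2 ⟨γ₀, fun γ => HexMidEdgeSAW.ext
      ((verts_eq_singleton_of_source_port hu hv hvw γ).trans (verts_eq_singleton_of_source_port hu hv hvw γ₀).symm)⟩
  rw [portMass, Finset.sum_congr rfl fun γ _ => by
    rw [HexMidEdgeSAW.length, verts_eq_singleton_of_source_port hu hv hvw γ, List.length_singleton, pow_one],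
    Finset.sum_const, Finset.card_univ, hcard, one_smul]

/-- **The witness in terms of the two generating functions**: `AdjacentPortWitness` holds iff some adjacent configuration has
`m(p)·(x_c + m(q)) < 4·x_c·m(q)` (`m(p) = x_c R_mid`, `m(q) = x_c R_far`: the transfer-matrix margin `R_mid(1+R_far) − 4R_far < 0`).
[cite: DuminilCopinSmirnov2012, §1–2] -/
theorem adjacentPortWitness_iff_source : AdjacentPortWitness ↔
    ∃ (Λ : Finset HexVertex) (u w₁ v p q : HexVertex), AdjacentConfig Λ u w₁ v p q ∧
      portMass Λ s(u, w₁) v p * (hexCriticalFugacity + portMass Λ s(u, w₁) v q) <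
        4 * hexCriticalFugacity * portMass Λ s(u, w₁) v q := by
  constructor
  · rintro ⟨Λ, u, w₁, v, p, q, hc, hlt⟩
    refine ⟨Λ, u, w₁, v, p, q, hc, ?_⟩
    rwa [portMass_source_eq hc.2.1 hc.2.2.1 hc.2.2.2.1 hc.2.2.2.2.1 hc.2.2.2.2.2.1] at hlt
  · rintro ⟨Λ, u, w₁, v, p, q, hc, hlt⟩
    refine ⟨Λ, u, w₁, v, p, q, hc, ?_⟩
    rwa [portMass_source_eq hc.2.1 hc.2.2.1 hc.2.2.2.1 hc.2.2.2.2.1 hc.2.2.2.2.2.1]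

end Summit.CriticalPhenomena.SAWScalingLimit.Cruxes.SpinMonotone.AdjacentPort

end
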